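/-
Copyright (c) 2026 the pub-hodgecm-mathlib formalisation cell (harness21).  Prover seat hodgecm-mathlib-B-p08 (g40): LH4-plan (g6) WORD #40 price-list item (P1b)
«GLOBAL auxiliary quadratic wildly ramified at `v`» — the (W-unit) twin of ★ [T2-L] `RamifiedQuadraticDictionary` and the any-place twin of ★ (Q3)
`LocalSquareClassGlobalRepresentative`; 2026-09-02.
-/
import Literature.NumberTheory.NumberFields.RamifiedQuadraticDictionary        -- ★ [T2-L] (L1)(L2)(L3), ★ (Q1) (Q2) (Q5) (QP) (Q3), ★ `ramificationIdx'_eq_two_of_ne_one`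
import Literature.NumberTheory.LocalFields.CompleteValuedSquareRootNearOne     -- ★ `isSquare_of_valued_sub_one_lt_four_adicCompletion` (LH5-p03)
import HarnessLib

/-!
# The ramified quadratic dictionary at a WILD place, unit-discriminant row: `E_w = F_v(√(1 + w₀))`, `|4|_v < |w₀|_v = |ϖ_v|^{2k+1}`, the Eisenstein uniformiser
# `(α − 1) ∕ ι₁ϖ^k`, its coordinates, the two involutions; and a global representative of EVERY local square class

Topic `NumberTheory/NumberFields`; namespace `Literature.NumberTheory.NumberFields`.  THEOREMS ONLY (no definition, no instance, no notation, no named fact, no `sorry`);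
kernel lane `--supports stmt-HodgeConjecture-24833`.  Cell `pub/hodgecm-mathlib` (D-0151), crux H413 = `stmt-HodgeConjecture-24833`; half A line LH4 (dyadic pay-down),
LH4-plan (g6) WORD #40 price list, item **(P1b)** (census of record posted on the LH4 bus 2026-09-02T14:18Z: the dictionary ★ [T2-L] is residue-characteristic-free but
keyed on a UNIFORMISER `d` — rows (T) and (W-odd) —; the `|2|_v = 1` binder of the chain lives in the GLOBAL step ★ (Q3) `exists_isSquare_inv_mul_coe`; the (W-unit) row
`d = 1 + w₀` had no dictionary).  HONEST LABEL: HC_CM is proved only modulo the 7 printed citations (2 remaining named inputs: hLiu418 = stmt-HodgeConjecture-24832,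
h413 = stmt-HodgeConjecture-24833) until rung 0 closes; this file is count-neutral base layer (pays no organ, opens no road).

THE SETTING (★ [T2-L]'s, with the uniformiser binder `hd : |d|_v = exp(−1)` REPLACED by the wild-unit normal form of ★ (C4) `exists_unit_mul_sq_depth_dichotomy`).
`E ∕ F` quadratic number fields (`δ² = m`, `σ δ = −δ`, `δ ≠ 0`), `v` a finite place of `F`, `w ∣ v`, `ι₁ := toPlace v w : F_v →+* E_w`; `d = 1 + w₀ ∈ F_v` with
`|w₀|_v = exp(−(2k+1))` (ODD order) and `|4|_v < |w₀|_v` (so `v ∣ 2`, `2k + 1 < 2·ord_v 2`: the quadratic DEFECT of the unit `d` is `𝔭^{2k+1}`, [Omeara1963, §63A]), and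
`d⁻¹ m ∈ (F_v^×)²`; `ϖ ∈ F_v` a uniformiser.  Then:
* §0 (G) **`exists_isSquare_inv_mul_coe_of_ne_zero`** — at ANY finite place `w` of a number field `K`, every `d ∈ K_w^×` has a global `m ∈ K^×` with `d⁻¹ m ∈ (K_w^×)²`
  (density to radius `|4d|_w` + ★ `isSquare_of_valued_sub_one_lt_four_adicCompletion`): ★ (Q3) without its `|2|_w = 1` binder — the «global auxiliary quadratic»
  `K(√m)` realising a prescribed local quadratic extension exists at dyadic places too.
* §1 (W0) **`not_isSquare_one_add_of_valued_four_lt`** (pure valued-field algebra, any `K` with `Valued K ℤᵐ⁰`): `|4| < |w₀| = exp(−(2k+1)) ⇒ 1 + w₀ ∉ K²`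
  (`x² = 1 + w₀` gives `X(X + 2) = w₀` for `X = x − 1`; if `|X| ≠ |X + 2|` then `|2| = max(|X|, |X+2|)` and `|w₀| ≤ |4|`; if `|X| = |X + 2|` then `|w₀|` is a square value);
  reading lemmas `valued_one_add_eq_one_of_valued_eq_exp_neg`, `valued_two_mul_exp_le_of_valued_four_lt` (`|2∕ϖ^k| ≤ |ϖ|`), `valued_four_lt_of_valued_two_eq_exp`
  (`|2| = exp(−e)`, `k + 1 ≤ e ⇒ |4| < |w₀|`, for callers carrying `e`).
* §2 (W1) the NON-SPLIT ∕ RAMIFIED currency: `valued_eq_one_of_wildUnit`, `not_isSquare_coe_of_wildUnit`, `subsingleton_placesOver_of_wildUnit`,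
  `smul_placesOver_eq_of_wildUnit` (`σ • w = w`), `ramificationIdx'_ne_one_of_wildUnit` ((W0) run INSIDE `E_w` on `ι₁ w₀` under `|ι₁ y|_w = |y|_v ^ 1`),
  **`ramifiedPlace_currency_of_wildUnit`** (`σ ≠ 1 ∧ σ • w = w ∧ e(w|v) = 2`, the binders of the ramified-place packages with the ramification index).
* §3 (W2) = (L1u) **`exists_sqrt_and_coord_of_wildUnit`** — `∃ α ∈ E_w`, `α² = ι₁ d`, `|α|_w = 1`, the EISENSTEIN UNIFORMISER `(α − 1) ∕ ι₁ϖ^k` has `|·|_w = exp(−1)`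
  (`(α − 1)(α + 1) = ι₁ w₀` and `(α + 1) − (α − 1) = 2` force `|α − 1|_w = |α + 1|_w = |w₀|_v`), every `z ∈ E_w` is UNIQUELY `ι₁ p + ι₁ q·(α − 1)∕ι₁ϖ^k`, and
  `ι₁ p + ι₁ q·(α − 1)∕ι₁ϖ^k ∈ 𝒪[E_w] ⟺ p, q ∈ 𝒪[F_v]` (★ (Q5) §1 at `e(w|v) = 2`).  The uniformiser is spelled out (`Π` is a reserved token), as in ★
  `LocalFields/WildQuadraticEisensteinFrame`, whose two-field dress (`j := ι₁`) reads these outputs.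
* §4 (W3) = (L2u) **`exists_involutions_of_wildUnit`** — an involution `s` of `F_v` with `s d = d`, `s ϖ = ϖ`, `s 𝒪 ⊆ 𝒪` extends to `s̃ : E_w →+* E_w` over `s` with
  `s̃ α = α` (hence `s̃` fixes the Eisenstein uniformiser), `s̃ s̃ = id`, `s̃ 𝒪 ⊆ 𝒪`; and the `F_v`-linear involution `ι′` has `ι′ α = −α` (hence `ι′` sends the uniformiser
  `P` to `−P − ι₁(2∕ϖ^k)`, ★ `map_wildUniformizer`), `ι′ ι′ = id`, `ι′ 𝒪 ⊆ 𝒪` — token-parallel to ★ (L2) with `θ ↦ α`.  (L3) ★ `exists_mul_map_eq_of_ramified` (unit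
  norms for `s̃`) is `d`-free and applies verbatim.

## References
* [SerreLocalFields1979] J.-P. Serre, *Local Fields*, GTM 67 (1979): Ch. I §6 Prop. 17–18 (Eisenstein basis), Ch. II §3 (approximation), Ch. XIV §4 (squares among one-units).
* [Omeara1963] O. T. O'Meara, *Introduction to Quadratic Forms*, Grundlehren 117 (1963): §63A 63:2–63:5 (quadratic defect of a dyadic unit, `𝔭^t` with `t` odd `< 2e`).
* [Neukirch1999] J. Neukirch, *Algebraic Number Theory*, Grundlehren 322 (1999): Ch. II (3.4) (density), (8.2)–(8.3), Ch. V (3.1)–(3.3).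
* [Lang2002] S. Lang, *Algebra*, GTM 211 (2002): Ch. V §1 (the universal property of `K[X]⁄(f)`).
* [Jacobowitz1962] R. Jacobowitz, *Hermitian forms over local fields*, Amer. J. Math. 84 (1962): §§9–11 («R-U»: `E = F(√u)`, ramified dyadic).
-/

set_option autoImplicit false

noncomputable section

open NumberField IsDedekindDomain Polynomial Topology WithZero
open scoped ValuativeRel
open Literature.NumberTheory.Automorphic Literature.NumberTheory.Automorphic.UnitaryGroup

namespace Literature.NumberTheory.NumberFields

/-! ## §0 (G) A global representative of every local square class (★ (Q3) at ANY place) -/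

/-- **EVERY LOCAL SQUARE CLASS HAS A GLOBAL REPRESENTATIVE, AT ANY PLACE.**  For a finite place `w` of the number field `K` (any residue characteristic) and `d ∈ K_w^×`
there is `m ∈ K^×` with `d⁻¹ m` a square in `K_w`: pick `m` with `|m − d|_w < |4d|_w` (★ `exists_algebraMap_valued_sub_lt`-style density, ★ `ball_mem_nhds`); then
`|d⁻¹m − 1|_w < |4|_w` and ★ `isSquare_of_valued_sub_one_lt_four_adicCompletion` (Hensel at the approximate root `1` of `X² − s`, `|s − 1| < |f′(1)|²`).  This is ★ (Q3)
`LocalSquareClassGlobalRepresentative.exists_isSquare_inv_mul_coe` with its `|2|_w = 1` binder removed; it supersedes, at `v ∣ 2`, the two `|2|_v = 1` readers ★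
`exists_isSquare_inv_mul_coe` and ★ `QuadraticRamifiedAtOddValuationPlace.exists_coe_isSquare_inv_mul_and_valued_eq_exp_odd` (the «global auxiliary quadratic `K(√m)`
realising a prescribed local class» step of the (D2-β) ∕ (D5) chain). [cite: Neukirch1999, Ch. II (3.4)] [cite: SerreLocalFields1979, Ch. XIV §4] -/
theorem exists_isSquare_inv_mul_coe_of_ne_zero {K : Type} [Field K] [NumberField K] (w : HeightOneSpectrum (𝓞 K)) {d : w.adicCompletion K} (hd : d ≠ 0) :
    ∃ m : K, m ≠ 0 ∧ IsSquare (d⁻¹ * algebraMap K (w.adicCompletion K) m) := by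
  have hvd : Valued.v d ≠ 0 := (Valuation.ne_zero_iff _).2 hd
  have h40 : (4 : w.adicCompletion K) ≠ 0 := by
    rw [← map_ofNat (algebraMap K (w.adicCompletion K)) 4]
    exact (_root_.map_ne_zero _).2 (by norm_num)
  have hv40 : Valued.v (4 * d) ≠ 0 := (Valuation.ne_zero_iff _).2 (mul_ne_zero h40 hd)
  have hval : ∀ x : K, Valued.v (algebraMap K (w.adicCompletion K) x) = w.valuation K x := fun x =>
    HeightOneSpectrum.valuedAdicCompletion_eq_valuation' w x
  have h4le : Valued.v (4 : w.adicCompletion K) ≤ 1 := by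
    rw [← map_ofNat (algebraMap K (w.adicCompletion K)) 4, hval, show (4 : K) = ((4 : 𝓞 K) : K) from rfl]
    exact HeightOneSpectrum.valuation_le_one w _
  -- density of `K` in `K_w` to radius `|4d|`
  have hnhds : {y : w.adicCompletion K | Valued.v (y - d) < Valued.v (4 * d)} ∈ 𝓝 d := ball_mem_nhds w d (4 * d) hv40
  obtain ⟨y, hyU, ⟨m, rfl⟩⟩ := mem_closure_iff_nhds.1 (HeightOneSpectrum.denseRange_algebraMap (K := K) w d) _ hnhds
  have hm : Valued.v (algebraMap K (w.adicCompletion K) m - d) < Valued.v (4 * d) := hyU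
  have hm0 : m ≠ 0 := by
    rintro rfl
    rw [map_zero, zero_sub, Valuation.map_neg, map_mul] at hm
    exact absurd hm (not_lt.2 (mul_le_of_le_one_left zero_le h4le))
  refine ⟨m, hm0, ?_⟩
  set x : w.adicCompletion K := d⁻¹ * algebraMap K (w.adicCompletion K) m with hx
  have hx1 : Valued.v (x - 1) < Valued.v (4 : w.adicCompletion K) := by
    have : x - 1 = d⁻¹ * (algebraMap K (w.adicCompletion K) m - d) := by
      rw [hx, mul_sub, inv_mul_cancel₀ hd]
    rw [this, map_mul, map_inv₀]
    calc (Valued.v d)⁻¹ * Valued.v (algebraMap K (w.adicCompletion K) m - d) < (Valued.v d)⁻¹ * Valued.v (4 * d) :=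
          mul_lt_mul_of_pos_left hm (inv_pos.2 (zero_lt_iff.2 hvd))
      _ = Valued.v (4 : w.adicCompletion K) := by rw [map_mul, mul_comm (Valued.v (4 : w.adicCompletion K)) (Valued.v d), inv_mul_cancel_left₀ hvd]
  exact Literature.NumberTheory.LocalFields.isSquare_of_valued_sub_one_lt_four_adicCompletion K w x hx1

/-! ## §1 (W0) The unit `1 + w₀` of odd quadratic defect is not a square (pure valued-field algebra) -/

section Pure

variable {K : Type*} [Field K] [Valued K ℤᵐ⁰]

/-- In `ℤᵐ⁰`: a product `a·a` is never `exp` of an odd integer. [folklore] -/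
private theorem mul_self_ne_exp_odd (a : ℤᵐ⁰) (n : ℤ) : a * a ≠ exp (2 * n + 1) := by
  intro h
  have ha0 : a ≠ 0 := by
    intro h0; rw [h0, mul_zero] at h; exact exp_ne_zero h.symm
  rw [← exp_log ha0, ← exp_add, exp_inj] at h
  omega

/-- **(W0) `|4| < |w₀| = exp(−(2k+1)) ⇒ 1 + w₀` IS NOT A SQUARE** (the unit `1 + w₀` has odd quadratic defect `𝔭^{2k+1}`, `2k+1 < 2·ord 2`): writing `x² = 1 + w₀` as
`X·(X + 2) = w₀` with `X = x − 1`, either `|X| = |X + 2|` — then `|w₀| = |X|²` is a square value, not `exp` of an odd integer — or `|X| ≠ |X + 2|` — then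
`|2| = |(X + 2) − X| = max(|X|, |X + 2|)` and `|w₀| = |X|·|X + 2| ≤ |2|² = |4|`. [cite: Omeara1963, §63A 63:2–63:5] [cite: SerreLocalFields1979, Ch. XIV §4] -/
theorem not_isSquare_one_add_of_valued_four_lt {w₀ : K} {k : ℕ} (hw₀ : Valued.v w₀ = exp (-(2 * (k : ℤ) + 1)))
    (h4 : Valued.v (4 : K) < Valued.v w₀) : ¬ IsSquare (1 + w₀) := by
  rintro ⟨x, hx⟩
  set X : K := x - 1 with hXdef
  have hX : X * (X + 2) = w₀ := by rw [hXdef]; linear_combination -hx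
  by_cases hval : Valued.v X = Valued.v (X + 2)
  · -- `|w₀| = |X|²`: parity
    have h := congrArg Valued.v hX
    rw [map_mul, ← hval, hw₀, show -(2 * (k : ℤ) + 1) = 2 * (-(k : ℤ) - 1) + 1 by ring] at h
    exact mul_self_ne_exp_odd _ _ h
  · -- `|2| = max(|X|, |X+2|)`, so `|w₀| ≤ |4|`
    have h2 : Valued.v (2 : K) = max (Valued.v (X + 2)) (Valued.v X) := by
      have hne : Valued.v (X + 2) ≠ Valued.v (-X) := by rw [Valuation.map_neg]; exact Ne.symm hval
      have h := Valuation.map_add_of_distinct_val _ hne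
      rwa [show X + 2 + -X = (2 : K) by ring, Valuation.map_neg] at h
    have hle : Valued.v w₀ ≤ Valued.v (4 : K) := by
      rw [← hX, map_mul, show (4 : K) = 2 * 2 by norm_num, map_mul, h2]
      exact mul_le_mul' (le_max_right _ _) (le_max_left _ _)
    exact absurd h4 (not_lt.2 hle)

/-- `|w₀| = exp(−(2k+1))` forces `|w₀| < 1`, `w₀ ≠ 0`, `|1 + w₀| = 1` (a one-unit). [cite: SerreLocalFields1979, Ch. II §1] [cite: Omeara1963, §63A 63:1] -/
theorem valued_one_add_eq_one_of_valued_eq_exp_neg {w₀ : K} {k : ℕ} (hw₀ : Valued.v w₀ = exp (-(2 * (k : ℤ) + 1))) :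
    Valued.v w₀ < 1 ∧ w₀ ≠ 0 ∧ Valued.v (1 + w₀) = 1 := by
  have hlt : Valued.v w₀ < 1 := by rw [hw₀, ← exp_zero, exp_lt_exp]; omega
  refine ⟨hlt, (Valuation.ne_zero_iff _).1 (by rw [hw₀]; exact exp_ne_zero), ?_⟩
  have h1 : Valued.v w₀ < Valued.v (1 : K) := by rw [Valuation.map_one]; exact hlt
  rw [Valuation.map_add_eq_of_lt_left _ h1, Valuation.map_one]

/-- `|4| < |w₀| = exp(−(2k+1))` forces `|2|·exp(k) ≤ exp(−1)`: `2·log|2| < −(2k+1)`, so `log|2| ≤ −(k+1)` — the integrality of `2∕ϖ^k`. [cite: Omeara1963, §63A 63:2] -/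
theorem valued_two_mul_exp_le_of_valued_four_lt {w₀ : K} {k : ℕ} (hw₀ : Valued.v w₀ = exp (-(2 * (k : ℤ) + 1)))
    (h4 : Valued.v (4 : K) < Valued.v w₀) : Valued.v (2 : K) * exp (k : ℤ) ≤ exp (-1 : ℤ) := by
  rcases eq_or_ne (Valued.v (2 : K)) 0 with h20 | h20
  · rw [h20, zero_mul]; exact zero_le
  rw [show (4 : K) = 2 * 2 by norm_num, map_mul, hw₀, ← exp_log h20, ← exp_add, exp_lt_exp] at h4
  rw [← exp_log h20, ← exp_add, exp_le_exp]
  omega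

/-- **READING LEMMA for callers who carry `e = ord 2`**: `|2| = exp(−e)` and `k + 1 ≤ e` give the intrinsic binder `|4| < |w₀|` (`|w₀| = exp(−(2k+1))`) of this file —
`2k + 1 < 2e`, i.e. the defect order is below `2·ord 2` ([Omeara1963, §63A 63:2]; ★ `WildQuadraticEisensteinFrame.succ_le_of_skew` is the converse reading).
[cite: Omeara1963, §63A 63:2] -/
theorem valued_four_lt_of_valued_two_eq_exp {w₀ : K} {k e : ℕ} (hw₀ : Valued.v w₀ = exp (-(2 * (k : ℤ) + 1)))
    (he : Valued.v (2 : K) = exp (-(e : ℤ))) (hke : k + 1 ≤ e) : Valued.v (4 : K) < Valued.v w₀ := by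
  rw [show (4 : K) = 2 * 2 by norm_num, map_mul, he, hw₀, ← exp_add, exp_lt_exp]; omega

end Pure

/-! ## §2 (W1) The non-split ∕ ramified currency at the wild unit-discriminant row -/

section Place

variable {F : Type} (E : Type) [Field F] [NumberField F] [Field E] [NumberField E] [Algebra F E] [Algebra.IsQuadraticExtension F E]
  (v : HeightOneSpectrum (𝓞 F)) (σ : E ≃ₐ[F] E) {δ : E} (hσδ : σ δ = -δ) (hδ : δ ≠ 0) {m : F} (hm : algebraMap F E m = δ ^ 2)
  {d w₀ : v.adicCompletion F} (hdw : d = 1 + w₀) {k : ℕ} (hw₀ : Valued.v w₀ = exp (-(2 * (k : ℤ) + 1)))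
  (h4 : Valued.v (4 : v.adicCompletion F) < Valued.v w₀) (hdm : IsSquare (d⁻¹ * (m : v.adicCompletion F)))
  {ϖ : v.adicCompletion F} (hϖ : Valued.v ϖ = exp (-1 : ℤ)) (w : PlacesOver E v)

include hdw hw₀ in
/-- The wild unit `d = 1 + w₀` is a unit: `|d|_v = 1`, `d ≠ 0`. [cite: Omeara1963, §63A 63:1] [cite: SerreLocalFields1979, Ch. II §1] -/
theorem valued_eq_one_of_wildUnit : Valued.v d = 1 ∧ d ≠ 0 := by
  have h := (valued_one_add_eq_one_of_valued_eq_exp_neg hw₀).2.2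
  rw [← hdw] at h
  exact ⟨h, (Valuation.ne_zero_iff _).1 (by rw [h]; exact one_ne_zero)⟩

include hδ hm hdw hw₀ h4 hdm in
omit [NumberField E] [Algebra.IsQuadraticExtension F E] in
/-- `m` is not a square in `F_v` either (`d⁻¹ m ∈ (F_v^×)²`, `m ≠ 0` as `δ ≠ 0`). [cite: Neukirch1999, Ch. II (8.2)–(8.3)] -/
theorem not_isSquare_coe_of_wildUnit : ¬ IsSquare (m : v.adicCompletion F) := by
  have hns : ¬ IsSquare d := hdw ▸ not_isSquare_one_add_of_valued_four_lt hw₀ h4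
  have hd0 : d ≠ 0 := (valued_eq_one_of_wildUnit v hdw hw₀).2
  obtain ⟨s, hs⟩ := hdm
  have hm' : (m : v.adicCompletion F) = d * (s * s) := by rw [← hs, mul_inv_cancel_left₀ hd0]
  have hmv0 : (m : v.adicCompletion F) ≠ 0 := by
    intro h0
    have hm0 : m = 0 := (map_eq_zero_iff _ (algebraMap F (v.adicCompletion F)).injective).1 h0
    rw [hm0, map_zero] at hm
    exact hδ (pow_eq_zero_iff two_ne_zero |>.1 hm.symm)
  have hs0 : s ≠ 0 := by rintro rfl; rw [mul_zero, mul_zero] at hm'; exact hmv0 hm'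
  rintro ⟨t, ht⟩
  refine hns ⟨t * s⁻¹, ?_⟩
  have hd' : d = (m : v.adicCompletion F) * (s * s)⁻¹ := by rw [hm', mul_inv_cancel_right₀ (mul_ne_zero hs0 hs0)]
  rw [hd', ht]
  field_simp

include hσδ hδ hm hdw hw₀ h4 hdm in
/-- **`v` is NON-SPLIT in `E`** at the wild unit-discriminant row: exactly one place of `E` above `v` (★ (QP) `subsingleton_placesOver_of_not_isSquare`).
[cite: Neukirch1999, Ch. II (8.2)–(8.3)] [cite: CasselsFrohlich1967, Ch. II §10] -/
theorem subsingleton_placesOver_of_wildUnit : Subsingleton (PlacesOver E v) :=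
  subsingleton_placesOver_of_not_isSquare E v σ hσδ hδ hm (not_isSquare_coe_of_wildUnit E v hδ hm hdw hw₀ h4 hdm)

include hσδ hδ hm hdw hw₀ h4 hdm in
/-- … so the involution fixes the place: `σ • w = w` (the `hw` binder of `galAdicCompletionMap`). [cite: CasselsFrohlich1967, Ch. II §10] -/
theorem smul_placesOver_eq_of_wildUnit : σ • w.1 = w.1 :=
  haveI := subsingleton_placesOver_of_wildUnit E v σ hσδ hδ hm hdw hw₀ h4 hdm
  smul_placesOver_eq_of_subsingleton E v σ w

include hσδ hδ hm hdw hw₀ h4 hdm in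
/-- **`e(w|v) ≠ 1`** at the wild unit-discriminant row: `ι₁ d = 1 + ι₁ w₀` IS a square in `E_w` (★ (Q1)), so if `e(w|v) = 1` — `|ι₁ y|_w = |y|_v` (★ `valued_toPlace`) — the
pure lemma (W0) run inside `E_w` on `ι₁ w₀` (`|ι₁ 4|_w < |ι₁ w₀|_w = exp(−(2k+1))`) is contradicted. [cite: SerreLocalFields1979, Ch. I §6] [cite: Omeara1963, §63A 63:3] -/
theorem ramificationIdx'_ne_one_of_wildUnit : v.asIdeal.ramificationIdx' w.1.asIdeal ≠ 1 := by
  intro he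
  have hns : ¬ IsSquare d := hdw ▸ not_isSquare_one_add_of_valued_four_lt hw₀ h4
  obtain ⟨e, -, he_root⟩ := exists_ringEquiv_adjoinRoot_X_sq_sub_C E v σ hσδ hδ hm hns hdm w
  have hval : ∀ y : v.adicCompletion F, Valued.v (toPlace v w y) = Valued.v y := fun y => by rw [valued_toPlace, he, pow_one]
  have hw₀' : Valued.v (toPlace v w w₀) = exp (-(2 * (k : ℤ) + 1)) := by rw [hval, hw₀]
  have h4' : Valued.v (4 : w.1.adicCompletion E) < Valued.v (toPlace v w w₀) := by
    rw [← map_ofNat (toPlace v w) 4, hval, hval]; exact h4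
  refine not_isSquare_one_add_of_valued_four_lt hw₀' h4' ⟨e (AdjoinRoot.root (X ^ 2 - C d)), ?_⟩
  rw [← map_one (toPlace v w), ← map_add, ← hdw, ← sq, he_root]

include hσδ hδ hm hdw hw₀ h4 hdm in
/-- **THE RAMIFIED-PLACE CURRENCY AT THE WILD UNIT-DISCRIMINANT ROW, with `e(w|v) = 2`**: `σ ≠ 1 ∧ σ • w = w ∧ e(w|v) = 2` — the binders `(hc, hw)` of ★
`ramificationIdx'_eq_two_of_ne_one` ∕ ★ `inertiaDeg_eq_one_of_ne_one` ∕ ★ `natCard_residueField_eq_of_ramified` ∕ ★ `residueHom_galAdicCompletionMap_eq_id_of_ramified` together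
with the ramification index itself (`e ≠ 1` is `ramificationIdx'_ne_one_of_wildUnit`; `e = 2` by ★ `ramificationIdx'_eq_two_of_ne_one`) — the (W-unit) twin of ★
`ramifiedPlace_currency_of_valued_eq_exp_odd` + ★ `ramificationIdx'_eq_two_of_uniformizer`. [cite: Neukirch1999, Ch. II §8] [cite: SerreLocalFields1979, Ch. I §4] -/
theorem ramifiedPlace_currency_of_wildUnit : σ ≠ 1 ∧ σ • w.1 = w.1 ∧ v.asIdeal.ramificationIdx' w.1.asIdeal = 2 :=
  ⟨algEquiv_ne_one_of_apply_eq_neg E σ hσδ hδ, smul_placesOver_eq_of_wildUnit E v σ hσδ hδ hm hdw hw₀ h4 hdm w,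
    Liu2021.LemD1IndexedNonVacuityRamifiedPlace.ramificationIdx'_eq_two_of_ne_one E v σ (algEquiv_ne_one_of_apply_eq_neg E σ hσδ hδ) w
      (smul_placesOver_eq_of_wildUnit E v σ hσδ hδ hm hdw hw₀ h4 hdm w) (ramificationIdx'_ne_one_of_wildUnit E v σ hσδ hδ hm hdw hw₀ h4 hdm w)⟩

/-! ## §3 (W2) = (L1u) `α = √d`, the Eisenstein uniformiser `(α − 1) ∕ ι₁ϖ^k` and its coordinates -/

include hσδ hδ hm hdw hw₀ h4 hdm in
/-- **`|α − 1|_w = exp(−(2k+1))` and `|α|_w = 1` for ANY `α ∈ E_w` with `α² = ι₁ d`** (`e(w|v) = 2` normalisation): `(α − 1)(α + 1) = ι₁ w₀` has `|·|_w = |w₀|_v² =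
exp(−2(2k+1))` while `(α + 1) − (α − 1) = 2` has `|2|_w = |2|_v² < |w₀|_v`; if `|α − 1| ≠ |α + 1|` then `|2|_w = max` and `|w₀|_v² ≤ |2|_w² = |4|_v² < |w₀|_v²` — absurd;
so `|α − 1|_w = |α + 1|_w = exp(−(2k+1))`. [cite: Omeara1963, §63A 63:3] [cite: SerreLocalFields1979, Ch. I §6] -/
theorem valued_sqrt_sub_one_of_wildUnit {α : w.1.adicCompletion E} (hα : α ^ 2 = toPlace v w d) :
    Valued.v (α - 1) = exp (-(2 * (k : ℤ) + 1)) ∧ Valued.v α = 1 := by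
  have he : v.asIdeal.ramificationIdx' w.1.asIdeal = 2 := (ramifiedPlace_currency_of_wildUnit E v σ hσδ hδ hm hdw hw₀ h4 hdm w).2.2
  have hval : ∀ y : v.adicCompletion F, Valued.v (toPlace v w y) = Valued.v y ^ 2 := fun y => by rw [valued_toPlace, he]
  obtain ⟨hw1, hw0, hd1⟩ := valued_one_add_eq_one_of_valued_eq_exp_neg hw₀
  -- `|α| = 1`
  have hαv : Valued.v α = 1 := by
    have h := congrArg Valued.v hα
    rw [map_pow, hval, hdw, hd1, one_pow] at h
    have hα0 : Valued.v α ≠ 0 := by intro h0; rw [h0, zero_pow two_ne_zero] at h; exact zero_ne_one h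
    rw [← exp_log hα0, ← exp_nsmul, ← exp_zero, exp_inj] at h
    rw [← exp_log hα0, ← exp_zero, exp_inj]
    simp only [nsmul_eq_mul] at h
    omega
  refine ⟨?_, hαv⟩
  have hprod : Valued.v (α - 1) * Valued.v (α + 1) = exp (-(2 * (2 * (k : ℤ) + 1))) := by
    rw [← map_mul, show (α - 1) * (α + 1) = α ^ 2 - 1 by ring, hα, ← map_one (toPlace v w), ← map_sub, hdw, add_sub_cancel_left, hval, hw₀,
      ← exp_nsmul, nsmul_eq_mul, exp_inj]
    omega
  have h2 : Valued.v (2 : w.1.adicCompletion E) * Valued.v (2 : w.1.adicCompletion E) < exp (-(2 * (2 * (k : ℤ) + 1))) := by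
    rw [← map_mul, show (2 : w.1.adicCompletion E) * 2 = toPlace v w 4 by rw [map_ofNat]; norm_num, hval]
    rcases eq_or_ne (Valued.v (4 : v.adicCompletion F)) 0 with h40 | h40
    · rw [h40, zero_pow two_ne_zero]; exact zero_lt_iff.2 exp_ne_zero
    · have h4' := h4
      rw [hw₀, ← exp_log h40, exp_lt_exp] at h4'
      rw [← exp_log h40, ← exp_nsmul, exp_lt_exp, nsmul_eq_mul]
      push_cast
      omega
  by_cases hne : Valued.v (α - 1) = Valued.v (α + 1)
  · rw [← hne] at hprod
    have h0 : Valued.v (α - 1) ≠ 0 := by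
      intro h0; rw [h0, mul_zero] at hprod; exact exp_ne_zero hprod.symm
    rw [← exp_log h0, ← exp_add, exp_inj] at hprod
    rw [← exp_log h0, exp_inj]
    omega
  · exfalso
    have hmax : Valued.v (2 : w.1.adicCompletion E) = max (Valued.v (α + 1)) (Valued.v (α - 1)) := by
      have hne' : Valued.v (α + 1) ≠ Valued.v (-(α - 1)) := by rw [Valuation.map_neg]; exact Ne.symm hne
      rw [show (2 : w.1.adicCompletion E) = (α + 1) + -(α - 1) by ring, Valuation.map_add_of_distinct_val _ hne', Valuation.map_neg]
    have hle : Valued.v (α - 1) * Valued.v (α + 1) ≤ Valued.v (2 : w.1.adicCompletion E) * Valued.v (2 : w.1.adicCompletion E) := by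
      rw [hmax]; exact mul_le_mul' (le_max_right _ _) (le_max_left _ _)
    rw [hprod] at hle
    exact absurd h2 (not_lt.2 hle)

include hσδ hδ hm hdw hw₀ h4 hdm hϖ in
/-- **THE EISENSTEIN UNIFORMISER `(α − 1) ∕ ι₁ϖ^k`** has `|·|_w = exp(−1)`: `exp(−(2k+1)) ∕ exp(−2k)`. [cite: SerreLocalFields1979, Ch. I §6 Prop. 18] [cite: Omeara1963, §63A 63:3]
[cite: Jacobowitz1962, §§9–11] -/
theorem valued_wildUniformizer_of_wildUnit {α : w.1.adicCompletion E} (hα : α ^ 2 = toPlace v w d) :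
    Valued.v ((α - 1) / toPlace v w ϖ ^ k) = exp (-1 : ℤ) := by
  have he : v.asIdeal.ramificationIdx' w.1.asIdeal = 2 := (ramifiedPlace_currency_of_wildUnit E v σ hσδ hδ hm hdw hw₀ h4 hdm w).2.2
  rw [map_div₀, map_pow, (valued_sqrt_sub_one_of_wildUnit E v σ hσδ hδ hm hdw hw₀ h4 hdm w hα).1, valued_toPlace, he, hϖ, ← exp_nsmul, ← exp_nsmul,
    ← exp_sub, exp_inj]
  simp only [nsmul_eq_mul]
  push_cast
  ring

include hσδ hδ hm hdw hw₀ h4 hdm hϖ in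
/-- **COORDINATES ON `(1, (α − 1)∕ι₁ϖ^k)`**: every `z ∈ E_w` is UNIQUELY `ι₁ p + ι₁ q·(α − 1)∕ι₁ϖ^k` — existence from the `(1, α)` coordinates of ★ (Q5) §3
(`ι₁ a + ι₁ b·α = ι₁ (a + b) + ι₁ (b ϖ^k)·(α − 1)∕ι₁ϖ^k`), uniqueness because `|(α − 1)∕ι₁ϖ^k|_w = exp(−1)` is not a value `|ι₁ x|_w = |x|_v²`.
[cite: SerreLocalFields1979, Ch. I §6 Prop. 18] [cite: Neukirch1999, Ch. II (8.2)–(8.3)] -/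
theorem existsUnique_coord_wildUniformizer_of_wildUnit {α : w.1.adicCompletion E} (hα : α ^ 2 = toPlace v w d) (z : w.1.adicCompletion E) :
    ∃! pq : v.adicCompletion F × v.adicCompletion F, z = toPlace v w pq.1 + toPlace v w pq.2 * ((α - 1) / toPlace v w ϖ ^ k) := by
  have he : v.asIdeal.ramificationIdx' w.1.asIdeal = 2 := (ramifiedPlace_currency_of_wildUnit E v σ hσδ hδ hm hdw hw₀ h4 hdm w).2.2
  have hns : ¬ IsSquare d := hdw ▸ not_isSquare_one_add_of_valued_four_lt hw₀ h4
  have hP : Valued.v ((α - 1) / toPlace v w ϖ ^ k) = exp (-1 : ℤ) := valued_wildUniformizer_of_wildUnit E v σ hσδ hδ hm hdw hw₀ h4 hdm hϖ w hα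
  set P : w.1.adicCompletion E := (α - 1) / toPlace v w ϖ ^ k with hPdef
  have hϖ0 : ϖ ≠ 0 := (Valuation.ne_zero_iff _).1 (by rw [hϖ]; exact exp_ne_zero)
  have hιϖk : toPlace v w ϖ ^ k ≠ 0 := pow_ne_zero _ ((_root_.map_ne_zero (toPlace v w)).2 hϖ0)
  have hαP : α = 1 + toPlace v w (ϖ ^ k) * P := by
    rw [hPdef, map_pow, mul_div_cancel₀ _ hιϖk]; ring
  -- existence from the `(1, α)` coordinates
  obtain ⟨⟨a, b⟩, hab, -⟩ := existsUnique_eq_toPlace_add_toPlace_mul_of_sq_eq E v σ hσδ hδ hm hns hdm w hα z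
  simp only at hab
  refine ⟨⟨a + b, b * ϖ ^ k⟩, ?_, ?_⟩
  · simp only
    rw [hab, hαP, map_add, map_mul]; ring
  · rintro ⟨p, q⟩ hpq
    simp only at hpq ⊢
    -- uniqueness: `ι₁ (p − p′) = ι₁ (q′ − q)·P` with `|P| = exp(−1)` not a value `|x|_v²`
    have hP' : ∀ x y : v.adicCompletion F, toPlace v w x = toPlace v w y * P → y = 0 := by
      intro x y hxy
      by_contra hy
      have h := congrArg Valued.v hxy
      rw [map_mul, hP, valued_toPlace, valued_toPlace, he] at h
      have hy0 : Valued.v y ≠ 0 := (Valuation.ne_zero_iff _).2 hy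
      rcases eq_or_ne (Valued.v x) 0 with hx0 | hx0
      · rw [hx0, zero_pow two_ne_zero] at h
        exact (mul_ne_zero (pow_ne_zero _ hy0) exp_ne_zero) h.symm
      · rw [← exp_log hx0, ← exp_log hy0, ← exp_nsmul, ← exp_nsmul, ← exp_add, exp_inj, nsmul_eq_mul, nsmul_eq_mul] at h
        omega
    have h1 : toPlace v w p + toPlace v w q * P = toPlace v w (a + b) + toPlace v w (b * ϖ ^ k) * P := by
      rw [← hpq, hab, hαP, map_add, map_mul]; ring
    have hdiff : toPlace v w (p - (a + b)) = toPlace v w (b * ϖ ^ k - q) * P := by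
      rw [map_sub, map_sub]; linear_combination h1
    have hq : b * ϖ ^ k - q = 0 := hP' _ _ hdiff
    have hq' : q = b * ϖ ^ k := by linear_combination -hq
    rw [hq, map_zero, zero_mul, map_sub, sub_eq_zero] at hdiff
    have hp' : p = a + b := (toPlace v w).injective hdiff
    rw [hp', hq']

include hσδ hδ hm hdw hw₀ h4 hdm hϖ in
/-- **(L1u) `α = √d`, THE EISENSTEIN UNIFORMISER `(α − 1)∕ι₁ϖ^k` AND ITS COORDINATES** at the wild unit-discriminant row: `α² = ι₁ d`, `|α|_w = 1`,
`|(α − 1)∕ι₁ϖ^k|_w = exp(−1)`, every `z` is uniquely `ι₁ p + ι₁ q·(α − 1)∕ι₁ϖ^k`, and `ι₁ p + ι₁ q·(α − 1)∕ι₁ϖ^k ∈ 𝒪[E_w] ↔ p, q ∈ 𝒪[F_v]` (★ (Q5) §1 Eisenstein basis at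
`e(w|v) = 2`) — the (W-unit) twin of ★ (L1) `exists_sqrt_and_coord_of_ramified`. [cite: SerreLocalFields1979, Ch. I §6 Prop. 17–18] [cite: Neukirch1999, Ch. II (8.2)–(8.3)]
[cite: Omeara1963, §63A 63:3] [cite: Jacobowitz1962, §§9–11] -/
theorem exists_sqrt_and_coord_of_wildUnit :
    ∃ α : w.1.adicCompletion E, α ^ 2 = toPlace v w d ∧ Valued.v α = 1 ∧ Valued.v ((α - 1) / toPlace v w ϖ ^ k) = exp (-1 : ℤ) ∧
      (∀ z : w.1.adicCompletion E, ∃! pq : v.adicCompletion F × v.adicCompletion F,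
        z = toPlace v w pq.1 + toPlace v w pq.2 * ((α - 1) / toPlace v w ϖ ^ k)) ∧
      (∀ p q : v.adicCompletion F, toPlace v w p + toPlace v w q * ((α - 1) / toPlace v w ϖ ^ k) ∈ 𝒪[w.1.adicCompletion E] ↔
        p ∈ 𝒪[v.adicCompletion F] ∧ q ∈ 𝒪[v.adicCompletion F]) := by
  have he : v.asIdeal.ramificationIdx' w.1.asIdeal = 2 := (ramifiedPlace_currency_of_wildUnit E v σ hσδ hδ hm hdw hw₀ h4 hdm w).2.2
  have hns : ¬ IsSquare d := hdw ▸ not_isSquare_one_add_of_valued_four_lt hw₀ h4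
  obtain ⟨e, -, he_root⟩ := exists_ringEquiv_adjoinRoot_X_sq_sub_C E v σ hσδ hδ hm hns hdm w
  have hP : Valued.v ((e (AdjoinRoot.root (X ^ 2 - C d)) - 1) / toPlace v w ϖ ^ k) = exp (-1 : ℤ) :=
    valued_wildUniformizer_of_wildUnit E v σ hσδ hδ hm hdw hw₀ h4 hdm hϖ w he_root
  refine ⟨e (AdjoinRoot.root (X ^ 2 - C d)), he_root, (valued_sqrt_sub_one_of_wildUnit E v σ hσδ hδ hm hdw hw₀ h4 hdm w he_root).2, hP,
    fun z => existsUnique_coord_wildUniformizer_of_wildUnit E v σ hσδ hδ hm hdw hw₀ h4 hdm hϖ w he_root z, fun p q => ?_⟩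
  rw [toPlace_add_toPlace_mul_mem_integer_iff_of_ramified E v w he hP, mem_integer_iff_valued_le_one, mem_integer_iff_valued_le_one]

/-! ## §4 (W3) = (L2u) The two involutions of `E_w = F_v(α)` -/

include hσδ hδ hm hdw hw₀ h4 hdm in
/-- **`F_v[X]⁄(X² − d) ≃ E_w` THROUGH A GIVEN SQUARE ROOT** at the wild unit-discriminant row: for ANY `α ∈ E_w` with `α² = ι₁ d` the lift `AdjoinRoot.lift ι₁ α` is a ring
isomorphism `e` with `e ∘ of = ι₁` and `e(root) = α` (injective: `X² − d` irreducible as `d ∉ F_v²`; surjective: the `(1, α)` coordinates ★ (Q5) §3) — ★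
`exists_ringEquiv_adjoinRoot_of_sq_eq` with `hd` replaced by the wild-unit binders. [cite: Lang2002, Ch. V §1] [cite: Neukirch1999, Ch. II (8.2)–(8.3)] -/
theorem exists_ringEquiv_adjoinRoot_of_sq_eq_of_wildUnit {α : w.1.adicCompletion E} (hα : α ^ 2 = toPlace v w d) :
    ∃ e : AdjoinRoot (X ^ 2 - C d) ≃+* w.1.adicCompletion E,
      (∀ a : v.adicCompletion F, e (AdjoinRoot.of (X ^ 2 - C d) a) = toPlace v w a) ∧ e (AdjoinRoot.root (X ^ 2 - C d)) = α := by
  have hns : ¬ IsSquare d := hdw ▸ not_isSquare_one_add_of_valued_four_lt hw₀ h4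
  have hroot : (X ^ 2 - C d).eval₂ (toPlace v w) α = 0 := by
    rw [eval₂_sub, eval₂_X_pow, eval₂_C, hα, sub_self]
  let φ : AdjoinRoot (X ^ 2 - C d) →+* w.1.adicCompletion E := AdjoinRoot.lift (toPlace v w) α hroot
  haveI : Fact (Irreducible (X ^ 2 - C d)) := ⟨irreducible_X_sq_sub_C_of_not_isSquare d hns⟩
  have hinj : Function.Injective φ := φ.injective
  have hsurj : Function.Surjective φ := by
    intro z
    obtain ⟨pq, hpq, -⟩ := existsUnique_eq_toPlace_add_toPlace_mul_of_sq_eq E v σ hσδ hδ hm hns hdm w hα z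
    refine ⟨AdjoinRoot.of _ pq.1 + AdjoinRoot.of _ pq.2 * AdjoinRoot.root _, ?_⟩
    rw [map_add, map_mul, AdjoinRoot.lift_of, AdjoinRoot.lift_of, AdjoinRoot.lift_root, hpq]
  refine ⟨RingEquiv.ofBijective φ ⟨hinj, hsurj⟩, fun a => ?_, ?_⟩
  · exact AdjoinRoot.lift_of hroot
  · exact AdjoinRoot.lift_root hroot

include hσδ hδ hm hdw hw₀ h4 hdm hϖ in
/-- **(L2u) THE TWO INVOLUTIONS OF `E_w = F_v(α)`** at the wild unit-discriminant row: an involution `s` of `F_v` fixing `d` and `ϖ` (and preserving `𝒪`) extends to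
`s̃ : E_w →+* E_w` with `s̃ α = α` (`AdjoinRoot.lift (ι₁ ∘ s) α` through `e : F_v[X]⁄(X² − d) ≃ E_w`), `s̃ s̃ = id`, `s̃ 𝒪 ⊆ 𝒪` (read in the Eisenstein coordinates
`(1, (α − 1)∕ι₁ϖ^k)`, which `s̃` fixes); and the `F_v`-linear involution `ι′` has `ι′ α = −α`, `ι′ ι′ = id`, `ι′ 𝒪 ⊆ 𝒪` (`ι′` sends the uniformiser `P` to `−P − ι₁(2∕ϖ^k)`
and `|2∕ϖ^k|_v ≤ exp(−1)` by `|4| < |w₀|`).  Token-parallel to ★ (L2) `exists_involutions_of_ramified` with `θ ↦ α`. [cite: Lang2002, Ch. V §1]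
[cite: SerreLocalFields1979, Ch. I §6 Prop. 18] [cite: Jacobowitz1962, §§9–11] -/
theorem exists_involutions_of_wildUnit (s : v.adicCompletion F →+* v.adicCompletion F) (hss : ∀ x, s (s x) = x) (hsd : s d = d) (hsϖ : s ϖ = ϖ)
    (hsO : ∀ x : 𝒪[v.adicCompletion F], s x ∈ 𝒪[v.adicCompletion F])
    {α : w.1.adicCompletion E} (hα : α ^ 2 = toPlace v w d) :
    (∃ s' : w.1.adicCompletion E →+* w.1.adicCompletion E,
      (∀ x, s' (toPlace v w x) = toPlace v w (s x)) ∧ s' α = α ∧ (∀ z, s' (s' z) = z) ∧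
      (∀ z : 𝒪[w.1.adicCompletion E], s' z ∈ 𝒪[w.1.adicCompletion E])) ∧
    (∃ ι' : w.1.adicCompletion E →+* w.1.adicCompletion E,
      (∀ x, ι' (toPlace v w x) = toPlace v w x) ∧ ι' α = -α ∧ (∀ z, ι' (ι' z) = z) ∧
      (∀ z : 𝒪[w.1.adicCompletion E], ι' z ∈ 𝒪[w.1.adicCompletion E])) := by
  have hns : ¬ IsSquare d := hdw ▸ not_isSquare_one_add_of_valued_four_lt hw₀ h4
  set ι := toPlace v w with hιdef
  set P : w.1.adicCompletion E := (α - 1) / ι ϖ ^ k with hPdef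
  have hϖ0 : ϖ ≠ 0 := (Valuation.ne_zero_iff _).1 (by rw [hϖ]; exact exp_ne_zero)
  have hιϖk : ι ϖ ^ k ≠ 0 := pow_ne_zero _ ((_root_.map_ne_zero ι).2 hϖ0)
  -- coordinates on `(1, α)` (involutivity) and on `(1, P)` (integrality)
  have hcoordα : ∀ z : w.1.adicCompletion E, ∃ pq : v.adicCompletion F × v.adicCompletion F, z = ι pq.1 + ι pq.2 * α := fun z =>
    (existsUnique_eq_toPlace_add_toPlace_mul_of_sq_eq E v σ hσδ hδ hm hns hdm w hα z).exists
  have hcoordP : ∀ z : w.1.adicCompletion E, ∃ pq : v.adicCompletion F × v.adicCompletion F, z = ι pq.1 + ι pq.2 * P := fun z =>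
    (existsUnique_coord_wildUniformizer_of_wildUnit E v σ hσδ hδ hm hdw hw₀ h4 hdm hϖ w hα z).exists
  have he : v.asIdeal.ramificationIdx' w.1.asIdeal = 2 := (ramifiedPlace_currency_of_wildUnit E v σ hσδ hδ hm hdw hw₀ h4 hdm w).2.2
  have hP : Valued.v P = exp (-1 : ℤ) := valued_wildUniformizer_of_wildUnit E v σ hσδ hδ hm hdw hw₀ h4 hdm hϖ w hα
  have hint : ∀ p q : v.adicCompletion F, ι p + ι q * P ∈ 𝒪[w.1.adicCompletion E] ↔ p ∈ 𝒪[v.adicCompletion F] ∧ q ∈ 𝒪[v.adicCompletion F] := by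
    intro p q
    rw [hιdef, toPlace_add_toPlace_mul_mem_integer_iff_of_ramified E v w he hP, mem_integer_iff_valued_le_one, mem_integer_iff_valued_le_one]
  -- the isomorphism `e : F_v[X]⁄(X² − d) ≃ E_w` through `α`
  obtain ⟨e, he_of, he_root⟩ := exists_ringEquiv_adjoinRoot_of_sq_eq_of_wildUnit E v σ hσδ hδ hm hdw hw₀ h4 hdm w hα
  have hsymm_of : ∀ x, e.symm (ι x) = AdjoinRoot.of (X ^ 2 - C d) x := fun x => by
    rw [hιdef, ← he_of, RingEquiv.symm_apply_apply]
  have hsymm_root : e.symm α = AdjoinRoot.root (X ^ 2 - C d) := by rw [← he_root, RingEquiv.symm_apply_apply]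
  refine ⟨?_, ?_⟩
  · -- `s̃ := lift (ι ∘ s) α ∘ e⁻¹`
    have hroot : (X ^ 2 - C d).eval₂ (ι.comp s) α = 0 := by
      rw [eval₂_sub, eval₂_X_pow, eval₂_C, RingHom.comp_apply, hsd, hα, hιdef, sub_self]
    let ψ : AdjoinRoot (X ^ 2 - C d) →+* w.1.adicCompletion E := AdjoinRoot.lift (ι.comp s) α hroot
    let s' : w.1.adicCompletion E →+* w.1.adicCompletion E := ψ.comp e.symm.toRingHom
    have hs'ι : ∀ x, s' (ι x) = ι (s x) := fun x => by
      change ψ (e.symm (ι x)) = ι (s x)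
      rw [hsymm_of, AdjoinRoot.lift_of, RingHom.comp_apply]
    have hs'α : s' α = α := by
      change ψ (e.symm α) = α
      rw [hsymm_root, AdjoinRoot.lift_root]
    have hs'P : s' P = P := by
      rw [hPdef, map_div₀, map_pow, map_sub, map_one, hs'α, hs'ι, hsϖ]
    have hs'pqα : ∀ p q : v.adicCompletion F, s' (ι p + ι q * α) = ι (s p) + ι (s q) * α := fun p q => by
      rw [map_add, map_mul, hs'ι, hs'ι, hs'α]
    have hs'pqP : ∀ p q : v.adicCompletion F, s' (ι p + ι q * P) = ι (s p) + ι (s q) * P := fun p q => by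
      rw [map_add, map_mul, hs'ι, hs'ι, hs'P]
    refine ⟨s', fun x => hs'ι x, hs'α, fun z => ?_, fun z => ?_⟩
    · obtain ⟨pq, rfl⟩ := hcoordα z
      rw [hs'pqα, hs'pqα, hss, hss]
    · obtain ⟨pq, hpq⟩ := hcoordP z
      have hmem := z.2
      rw [hpq, hint] at hmem
      change s' (z : w.1.adicCompletion E) ∈ 𝒪[w.1.adicCompletion E]
      rw [hpq, hs'pqP, hint]
      exact ⟨hsO ⟨pq.1, hmem.1⟩, hsO ⟨pq.2, hmem.2⟩⟩
  · -- `ι′ := lift ι (−α) ∘ e⁻¹`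
    have hroot : (X ^ 2 - C d).eval₂ ι (-α) = 0 := by
      rw [eval₂_sub, eval₂_X_pow, eval₂_C, neg_sq, hα, hιdef, sub_self]
    let ψ : AdjoinRoot (X ^ 2 - C d) →+* w.1.adicCompletion E := AdjoinRoot.lift ι (-α) hroot
    let ι' : w.1.adicCompletion E →+* w.1.adicCompletion E := ψ.comp e.symm.toRingHom
    have hι'ι : ∀ x, ι' (ι x) = ι x := fun x => by
      change ψ (e.symm (ι x)) = ι x
      rw [hsymm_of, AdjoinRoot.lift_of]
    have hι'α : ι' α = -α := by
      change ψ (e.symm α) = -α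
      rw [hsymm_root, AdjoinRoot.lift_root]
    have hι'P : ι' P = -P - ι (2 / ϖ ^ k) := by
      have h1 : ι' P = (ι' α - 1) / ι ϖ ^ k := by
        rw [hPdef, map_div₀, map_pow, map_sub, map_one, hι'ι]
      rw [h1, hι'α, hPdef, map_div₀, map_ofNat, map_pow]
      field_simp
      ring
    have hι'pqα : ∀ p q : v.adicCompletion F, ι' (ι p + ι q * α) = ι p + ι (-q) * α := fun p q => by
      rw [map_add, map_mul, hι'ι, hι'ι, hι'α, map_neg]; ring
    have hι'pqP : ∀ p q : v.adicCompletion F, ι' (ι p + ι q * P) = ι (p - q * (2 / ϖ ^ k)) + ι (-q) * P := fun p q => by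
      have h1 : ι' (ι p + ι q * P) = ι p + ι q * ι' P := by rw [map_add, map_mul, hι'ι, hι'ι]
      rw [h1, hι'P, map_sub, map_neg, map_mul]; ring
    -- `|2 ∕ ϖ^k|_v ≤ exp(−1) ≤ 1`
    have h2ϖ : Valued.v (2 / ϖ ^ k : v.adicCompletion F) ≤ 1 := by
      rw [map_div₀, map_pow, hϖ, ← exp_nsmul, div_eq_mul_inv, ← exp_neg]
      simp only [nsmul_eq_mul, mul_neg, mul_one, neg_neg]
      exact (valued_two_mul_exp_le_of_valued_four_lt hw₀ h4).trans (by rw [← exp_zero, exp_le_exp]; norm_num)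
    refine ⟨ι', fun x => hι'ι x, hι'α, fun z => ?_, fun z => ?_⟩
    · obtain ⟨pq, rfl⟩ := hcoordα z
      rw [hι'pqα, hι'pqα, neg_neg]
    · obtain ⟨pq, hpq⟩ := hcoordP z
      have hmem := z.2
      rw [hpq, hint, mem_integer_iff_valued_le_one, mem_integer_iff_valued_le_one] at hmem
      change ι' (z : w.1.adicCompletion E) ∈ 𝒪[w.1.adicCompletion E]
      rw [hpq, hι'pqP, hint, mem_integer_iff_valued_le_one, mem_integer_iff_valued_le_one, Valuation.map_neg]
      refine ⟨?_, hmem.2⟩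
      refine (Valuation.map_sub _ _ _).trans (max_le hmem.1 ?_)
      rw [map_mul]
      exact mul_le_one' hmem.2 h2ϖ

end Place

end Literature.NumberTheory.NumberFields

end
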